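import Mathlib
import Summits.ResolutionOfSingularities.ResolutionOfSingularities.Theorems.HomologicalConductorPersistenceStaircaseRecords
import HarnessLib

/-!
# Rung S-2 `PersistenceSurface` (stmt-19970), stub C1 (`Sat₄`) — the INFINITE FAMILY `1/n(1,2)`, `n` odd:
# `ca(k[u,v]^{μ_n(1,2)}) = ca⁴ = s̲ann(M_{n−2}) ∩ s̲ann(M_{n−1})`, kernel-certified UNIFORMLY in `n`
# (chain W4.4b; T-V package, part 25; seat leafhand-res-homologicalconduct-10 gen 2)

[OURS · L1 w44b · rung S-2] Nothing here is a statement of the manuscript under review (Hironaka 2017);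
AI-written, weaker than expert review.

After the Veronese cones `1/n(1,1)` (part 23, the `i`-series `(1)`) and the isolated stage `1/8(1,5)` (part 24),
this file runs the gen-6 pipeline (isotypic splitting → record staircases → Ω-stable distinguished family →
`…CyclicQuotientIsotypic.cohomologyAnnihilator_eq_four_of_isotypicData`) on the SECOND infinite family of cyclic
quotient surface singularities, `U = k[u,v]^{μ_n(1,2)}` for every odd `n = 2b + 1 ≥ 3` (`ζ` a primitive `n`-th root
of unity, `n ∈ kˣ`).  Here `n/2 = [b + 1, 2]` has length `e = 2`, `i`-series `(2, 1)`, and the cospecial pieces are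
`M_{−2} = M_{n−2}` and `M_{−1} = M_{n−1}`; `U` is Gorenstein only for `n = 3` (`A₂`), so for `n ≥ 5` these are
non-Gorenstein rational stages of the `Sat₄` residual (`SaturationFourSurfaceResidual₄`, class (iii) of the hand
censuses #56/#57).  The record staircase of a class `a` with `a.val = α = 2A + ρ` (`ρ ∈ {0,1}`) is PARAMETRIC and
needs no table:

* generators `u^{α − 2s} v^{s}` for `s ≤ A` (drops `2`, drop class `−2`), followed — when `α` is odd — by the one
  generator `v^{A + b + 1}` (from `u v^{A}`: one drop `1`, drop class `−1`), so `Ω M_a ≅ M_{−2}^{A} ⊕ M_{−1}^{ρ}`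
  (`isSyzygy_one_oneTwo`);
* the family `{M_{−2}, M_{−1}}` is Ω-stable: `M_{−2} | Ω M_{−1}` (`α = 2b`, `A = b ≥ 1`) and `M_{−1} | Ω M_{−2}`
  (`α = 2b − 1` odd);
* **`cohomologyAnnihilator_one_two`** — for every odd `n ≥ 3`: `ca(U) = ca⁴(U)` and
  `x ∈ ca(U) ↔ x ∈ s̲ann(M_{−2}) ∩ s̲ann(M_{−1})`.

All arithmetic side conditions are linear in `(α, A, b, s)` and discharged by `omega`; no `decide`, no case table,
no hypothesis beyond the base-field arithmetic.

References: folklore (Auslander 1986 / Herzog 1978 mechanism; Wunram 1988 for the classical names «(co)special»);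
res-L1-w44b-idea-1 SC-TORIC v2 (OURS, memo); hand census HAND10G1-QIV-RETRACT §D/§F (OURS, memo: the `e = 2` rows of
the LAW table).
-/

-- single-problem summit: the doubled namespace component `ResolutionOfSingularities` is forced
set_option linter.dupNamespace false

noncomputable section

open CategoryTheory Literature.RingTheory.CohomologyAnnihilator MvPolynomial
open Summit.ResolutionOfSingularities.ResolutionOfSingularities.Theorems.NoZeno.SandwichCluster
open Summit.ResolutionOfSingularities.ResolutionOfSingularities.Theorems.HomologicalConductor.PersistenceAddCoverFamily
open Summit.ResolutionOfSingularities.ResolutionOfSingularities.Theorems.HomologicalConductor.PersistenceCyclicQuotientIsotypic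
open Summit.ResolutionOfSingularities.ResolutionOfSingularities.Theorems.HomologicalConductor.PersistenceCyclicQuotientIsotypicPieces
open Summit.ResolutionOfSingularities.ResolutionOfSingularities.Theorems.HomologicalConductor.PersistenceStaircaseRecords

universe u

namespace Summit.ResolutionOfSingularities.ResolutionOfSingularities.Theorems.HomologicalConductor.PersistenceCyclicQuotientOneTwo

/-! ## The parametric staircase of `1/n(1,2)`: elementary arithmetic -/

/-- The `u`-exponents `α − 2s` (`s ≤ A`), then `0`, are non-increasing. [folklore] -/
theorem antitone_stair (α A : ℕ) : Antitone fun s : ℕ => if s ≤ A then α - 2 * s else 0 := by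
  intro s t hst
  dsimp only
  split_ifs <;> omega

/-- The `v`-exponents `s` (`s ≤ A`), then `J ≥ A`, are non-decreasing. [folklore] -/
theorem monotone_stair (A J : ℕ) (hJ : A ≤ J) : Monotone fun s : ℕ => if s ≤ A then s else J := by
  intro s t hst
  dsimp only
  split_ifs <;> omega

/-- Values of small differences in `ZMod n`: for `y ≤ x` with `x − y < n`, `((x : ZMod n) − y).val = x − y`.
[folklore] -/
theorem val_natCast_sub_natCast {n : ℕ} [NeZero n] {x y : ℕ} (hyx : y ≤ x) (hlt : x - y < n) :
    (((x : ℕ) : ZMod n) - ((y : ℕ) : ZMod n)).val = x - y := by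
  rw [← Nat.cast_sub hyx, ZMod.val_natCast_of_lt hlt]

/-- A class `a : ZMod n` is the cast of `a.val + n` (one wrap-around). [folklore] -/
theorem natCast_val_add_self {n : ℕ} [NeZero n] (a : ZMod n) : ((a.val + n : ℕ) : ZMod n) = a := by
  rw [Nat.cast_add, ZMod.natCast_self, add_zero, ZMod.natCast_zmod_val]

/-- The value of `a − 2i` below the first wrap: `2i ≤ a.val`. [folklore] -/
theorem val_sub_two_mul_of_le {n : ℕ} [NeZero n] (a : ZMod n) {i : ℕ} (hi : 2 * i ≤ a.val) :
    (a - ((2 * i : ℕ) : ZMod n)).val = a.val - 2 * i := by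
  conv_lhs => rw [← ZMod.natCast_zmod_val a]
  exact val_natCast_sub_natCast hi (lt_of_le_of_lt (Nat.sub_le _ _) (ZMod.val_lt a))

/-- The value of `a − 2i` after exactly one wrap: `a.val < 2i ≤ a.val + n`. [folklore] -/
theorem val_sub_two_mul_of_lt {n : ℕ} [NeZero n] (a : ZMod n) {i : ℕ} (hlt : a.val < 2 * i)
    (hle : 2 * i ≤ a.val + n) : (a - ((2 * i : ℕ) : ZMod n)).val = a.val + n - 2 * i := by
  conv_lhs => rw [← natCast_val_add_self a]
  exact val_natCast_sub_natCast hle (by omega)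

/-- `(-1 : ZMod n).val = n − 1` for `n ≥ 1`. [folklore] -/
theorem val_neg_one' {n : ℕ} [NeZero n] (hn : 1 ≤ n) : ((-1 : ZMod n)).val = n - 1 := by
  have h : ((-1 : ZMod n)) = ((n - 1 : ℕ) : ZMod n) := by
    rw [Nat.cast_sub hn, ZMod.natCast_self, Nat.cast_one, zero_sub]
  rw [h, ZMod.val_natCast_of_lt (by omega)]

/-- `(-2 : ZMod n).val = n − 2` for `n ≥ 2`. [folklore] -/
theorem val_neg_two {n : ℕ} [NeZero n] (hn : 2 ≤ n) : ((-2 : ZMod n)).val = n - 2 := by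
  have h : ((-2 : ZMod n)) = ((n - 2 : ℕ) : ZMod n) := by
    rw [Nat.cast_sub hn, ZMod.natCast_self, Nat.cast_ofNat, zero_sub]
  rw [h, ZMod.val_natCast_of_lt (by omega)]

/-! ## The certificate -/

variable {k : Type u} [Field k] {n : ℕ} [NeZero n] {ζ : k} (hζ : IsPrimitiveRoot ζ n) (hn : (n : k) ≠ 0)
variable (U : Subalgebra k (MvPolynomial (Fin 2) k))
variable (hU : ∀ p, p ∈ U ↔ aeval (fun i : Fin 2 => C (ζ ^ (![1, 2] : Fin 2 → ℕ) i) * X i) p = p)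

set_option maxHeartbeats 1600000 in
set_option synthInstance.maxHeartbeats 400000 in
include hζ hn hU in
/-- **`Sat₄` and the exact centre for `k[u,v]^{μ_n(1,2)}`, every odd `n ≥ 3`, kernel-certified uniformly in `n`.**
With the weight pieces `M a = {p | σ₀ p = ζ^a p}` (`σ₀ : u ↦ ζu, v ↦ ζ²v`): `ca(U) = ca⁴(U)` and
`x ∈ ca(U) ↔ x` stably annihilates `M_{−2}` and `M_{−1}` (the duals of the specials `M_2`, `M_1`; `i`-series `(2,1)`
of `n/2 = [(n+1)/2, 2]`).  For `n ≥ 5` these stages are non-Gorenstein.  (Budgets raised locally as in parts 21–24: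
instance search for modules of semi-invariants over the subalgebra `U`.) [OURS · L1 w44b] -/
theorem cohomologyAnnihilator_one_two (hodd : Odd n) (hn3 : 3 ≤ n) :
    ∃ M : ZMod n → Submodule U ((restrictScalarsFunctor U (MvPolynomial (Fin 2) k)).obj
        (ModuleCat.of (MvPolynomial (Fin 2) k) (MvPolynomial (Fin 2) k))),
      (∀ (a : ZMod n) (p : MvPolynomial (Fin 2) k),
        (show ((restrictScalarsFunctor U (MvPolynomial (Fin 2) k)).obj
          (ModuleCat.of (MvPolynomial (Fin 2) k) (MvPolynomial (Fin 2) k))) from p) ∈ M a ↔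
        aeval (fun i : Fin 2 => C (ζ ^ (![1, 2] : Fin 2 → ℕ) i) * X i) p = C (ζ ^ a.val) * p) ∧
      cohomologyAnnihilator U = cohomologyAnnihilatorOfDegree U 4 ∧
      ∀ x : U, x ∈ cohomologyAnnihilator U ↔
        ∀ t : Fin 2, StablyAnnihilates U x (@ModuleCat.of U _ (M (![-2, -1] t)) _ (M (![-2, -1] t)).module) := by
  classical
  have hq : Nat.Coprime 2 n := Nat.coprime_two_left.mpr hodd
  obtain ⟨M, hM, ⟨e⟩⟩ := exists_isotypic_splitting hζ hn hq U hU
  obtain ⟨b, hb⟩ := hodd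
  have hb1 : 1 ≤ b := by omega
  -- the two cospecial classes and their values
  have hv1 : ((-1 : ZMod n)).val = n - 1 := val_neg_one' (by omega)
  have hv2 : ((-2 : ZMod n)).val = n - 2 := val_neg_two (by omega)
  -- per-class staircase data, `α = a.val = 2A + ρ`
  let A : ZMod n → ℕ := fun a => a.val / 2
  let μ : ZMod n → ℕ := fun a => a.val / 2 + a.val % 2
  let J : ZMod n → ℕ := fun a => if a.val % 2 = 1 then a.val / 2 + b + 1 else a.val / 2
  let c : ZMod n → ℕ → ℕ := fun a s => if s ≤ A a then a.val - 2 * s else 0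
  let j : ZMod n → ℕ → ℕ := fun a s => if s ≤ A a then s else J a
  let d : ZMod n → ℕ → ZMod n := fun a t => if t < A a then -2 else -1
  have hAJ : ∀ a, A a ≤ J a := fun a => by dsimp only [A, J]; split_ifs <;> omega
  have hval : ∀ a : ZMod n, a.val < n := fun a => ZMod.val_lt a
  -- the class of every generator
  have hcl : ∀ a s, ((c a s + 2 * j a s : ℕ) : ZMod n) = a := by
    intro a s
    dsimp only [c, j, J, A]
    by_cases hs : s ≤ a.val / 2
    · rw [if_pos hs, if_pos hs, show a.val - 2 * s + 2 * s = a.val by omega, ZMod.natCast_zmod_val]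
    · rw [if_neg hs, if_neg hs]
      by_cases hρ : a.val % 2 = 1
      · rw [if_pos hρ, show 0 + 2 * (a.val / 2 + b + 1) = a.val + n by omega, natCast_val_add_self]
      · rw [if_neg hρ, show 0 + 2 * (a.val / 2) = a.val by omega, ZMod.natCast_zmod_val]
  -- the drop classes: `−2` below `A`, `−1` at `A` (odd `α` only)
  have hψ : ∀ a t, t < μ a → d a t = a - ((c a t + 2 * j a (t + 1) : ℕ) : ZMod n) := by
    intro a t ht
    dsimp only [d, c, j, J, A, μ] at ht ⊢
    by_cases htA : t < a.val / 2
    · rw [if_pos htA, if_pos (le_of_lt htA), if_pos (Nat.succ_le_of_lt htA),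
        show a.val - 2 * t + 2 * (t + 1) = a.val + 2 by omega, Nat.cast_add, ZMod.natCast_zmod_val,
        Nat.cast_ofNat]
      ring
    · have htA' : t = a.val / 2 := by omega
      have hρ : a.val % 2 = 1 := by omega
      rw [if_neg htA, if_pos (le_of_eq htA'), if_neg (by omega), if_pos hρ,
        show a.val - 2 * t + 2 * (a.val / 2 + b + 1) = (a.val + n) + 1 by omega, Nat.cast_add,
        natCast_val_add_self, Nat.cast_one]
      ring
  -- `2 J ≡ a`
  have hJ : ∀ a, ((2 * J a : ℕ) : ZMod n) = a := by
    intro a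
    dsimp only [J]
    by_cases hρ : a.val % 2 = 1
    · rw [if_pos hρ, show 2 * (a.val / 2 + b + 1) = a.val + n by omega, natCast_val_add_self]
    · rw [if_neg hρ, show 2 * (a.val / 2) = a.val by omega, ZMod.natCast_zmod_val]
  -- the cover property of the staircase on `[0, J]`
  have hcov : ∀ a i, i ≤ J a → ∃ s, s ≤ μ a ∧ j a s ≤ i ∧ c a s ≤ ((a - ((2 * i : ℕ) : ZMod n) : ZMod n)).val := by
    intro a i hi
    dsimp only [J, μ, c, j, A] at hi ⊢
    by_cases hiA : i ≤ a.val / 2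
    · refine ⟨i, by omega, ?_, ?_⟩
      · rw [if_pos hiA]
      · rw [if_pos hiA, val_sub_two_mul_of_le a (by omega)]
    · have hρ : a.val % 2 = 1 := by
        by_contra hρ
        rw [if_neg hρ] at hi
        exact hiA hi
      rw [if_pos hρ] at hi
      by_cases hiJ : i < a.val / 2 + b + 1
      · refine ⟨a.val / 2, by omega, ?_, ?_⟩
        · rw [if_pos le_rfl]; omega
        · rw [if_pos le_rfl, val_sub_two_mul_of_lt a (by omega) (by omega)]
          omega
      · refine ⟨a.val / 2 + 1, by omega, ?_, ?_⟩
        · rw [if_neg (by omega), if_pos hρ]; omega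
        · rw [if_neg (by omega)]; exact Nat.zero_le _
  -- the staircase resolutions `Ω M_a ≅ Π_{t < μ a} M (d a t)`
  let M' : ZMod n → ModuleCat.{u} U := fun a => @ModuleCat.of U _ (M a) _ (M a).module
  let K : ZMod n → ModuleCat.{u} U := fun a => ModuleCat.of U (Π t : Fin (μ a), M (d a t))
  have hK : ∀ a, IsSyzygy 1 (M' a) (K a) := by
    intro a
    refine isSyzygy_one_staircase_of_lt hζ U hU M hM a (μ a) (c a) (j a) (antitone_stair a.val (A a))
      (monotone_stair (A a) (J a) (hAJ a)) (hcl a) (d a) (hψ a) ?_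
    exact isotypic_le_span_of_cover hζ U hU M hM a (μ a) (J a) (c a) (j a) (hcl a) (hJ a) (hcov a)
  -- the certificate data: distinguished family `{M_{−2}, M_{−1}}`
  let ψ' : Fin 2 → ZMod n := ![-2, -1]
  have hdψ : ∀ a t, ∃ s : Fin 2, d a t = ψ' s := by
    intro a t
    dsimp only [d]
    by_cases ht : t < A a
    · exact ⟨0, by rw [if_pos ht]; rfl⟩
    · exact ⟨1, by rw [if_neg ht]; rfl⟩
  have hfin : ∀ t, Module.Finite U (M' (ψ' t)) := fun t => finite_isotypic hζ 2 U hU M hM _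
  have hKD : ∀ a, IsRetractOfPower (ModuleCat.of U ((Π t, M' (ψ' t)) × U)) (K a) := by
    intro a
    refine IsRetractOfPower.piFamily (fun t : Fin (μ a) => M' (d a t)) fun t => ?_
    obtain ⟨s, heq⟩ := hdψ a t
    exact (isRetractOfPower_fst (ModuleCat.of U (Π t, M' (ψ' t))) (ModuleCat.of U U)).of_isRetractOfPower_gen
      ((isRetractOfPower_eval (fun t : Fin 2 => M' (ψ' t)) s).of_iso
        (LinearEquiv.toModuleIso (LinearEquiv.ofEq _ _ (by rw [heq]))))
  have hD : ∀ t, ∃ (s : Fin 2) (i : M' (ψ' t) ⟶ K (ψ' s)) (r : K (ψ' s) ⟶ M' (ψ' t)), i ≫ r = 𝟙 (M' (ψ' t)) := by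
    -- `M_{−2} | K_{−1}` (position `0`: `(-1).val = 2b`, `A = b ≥ 1`);
    -- `M_{−1} | K_{−2}` (position `b − 1 = A`: `(-2).val = 2b − 1` is odd)
    have hμ1 : μ (-1) = b := by dsimp only [μ]; rw [hv1]; omega
    have hμ2 : μ (-2) = b := by dsimp only [μ]; rw [hv2]; omega
    have hsrc : ∀ t : Fin 2, ∃ (s : Fin 2) (p : Fin (μ (ψ' s))), d (ψ' s) p = ψ' t := by
      intro t
      fin_cases t
      · refine ⟨1, ⟨0, by change 0 < μ (-1); omega⟩, ?_⟩
        change d (-1) 0 = -2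
        dsimp only [d, A]
        rw [if_pos (by rw [hv1]; omega)]
      · refine ⟨0, ⟨b - 1, by change b - 1 < μ (-2); omega⟩, ?_⟩
        change d (-2) (b - 1) = -1
        dsimp only [d, A]
        rw [if_neg (by rw [hv2]; omega)]
    intro t
    obtain ⟨s, p, hp⟩ := hsrc t
    let E : M (d (ψ' s) p) ≃ₗ[U] M (ψ' t) := LinearEquiv.ofEq _ _ (by rw [hp])
    refine ⟨s,
      @ModuleCat.ofHom U _ (M (ψ' t)) (Π t' : Fin (μ (ψ' s)), M (d (ψ' s) t'))
        _ (M (ψ' t)).module _ _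
        ((LinearMap.single U (fun t' : Fin (μ (ψ' s)) => M (d (ψ' s) t')) p) ∘ₗ E.symm.toLinearMap),
      @ModuleCat.ofHom U _ (Π t' : Fin (μ (ψ' s)), M (d (ψ' s) t')) (M (ψ' t))
        _ _ _ (M (ψ' t)).module (E.toLinearMap ∘ₗ LinearMap.proj p), ?_⟩
    apply ModuleCat.hom_ext
    refine LinearMap.ext fun x => ?_
    change E ((Pi.single p (E.symm x) : Π t' : Fin (μ (ψ' s)), M (d (ψ' s) t')) p) = x
    rw [Pi.single_eq_same, LinearEquiv.apply_symm_apply]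
  obtain ⟨h4, hiff⟩ := @cohomologyAnnihilator_eq_four_of_isotypicData k _ n _ ζ hζ hn 2 hq U hU (Fin 2) _ M' e
    K hK ψ' hfin hKD hD
  exact ⟨M, hM, h4, hiff⟩

end Summit.ResolutionOfSingularities.ResolutionOfSingularities.Theorems.HomologicalConductor.PersistenceCyclicQuotientOneTwo

end
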